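import Literature.NumberTheory.QuadraticForms.PrescribedNormClassesCM
import Literature.NumberTheory.Automorphic.Liu2021.Def411AdmissibleRescaling
import Literature.NumberTheory.Automorphic.Liu2021.AppendixC.DefC1toC3Aux
import HarnessLib

/-!
# [Liu2021, Def. 4.12] «`ε` is `μ`-admissible» ⟺ a parity of local symbols (first rung G2b, Liu currency)

Topic `NumberTheory/Automorphic/Liu2021`; namespace `Literature.NumberTheory.Automorphic.Liu2021`.  Theorems only
(no definition, no named fact, no `sorry`).

Yifeng Liu, *Fourier–Jacobi cycles and arithmetic relative trace formula*, Camb. J. Math. 9 (2021) = arXiv:2102.11518,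
Def. 4.12 (`FJcycle.tex` l. 2102–2108), AS PRINTED: «we say that `ε` is *`μ`-admissible* if there exists some
`e ∈ E^{×−}` such that `ε_v = e N_{E_v/F_v} E_v^×` for every nonarchimedean place `v` of `F`, and `τ'(e)` has negative
imaginary part for every `τ' ∈ Φ_μ`».  In the tree this is `∃ e, IsAdmissibleElement E Φ e ∧ Def411WeilCarriers.epsOf … δ e = ε`
(token for token the body of `Thm418Data.IsAdmissible` / `Prop413Data.Triple.IsAdmissible`), with the lane's fixed
`δ ∈ E^{×−}` normalising the collections (`Eps F d = Π_v F_vˣ/N(F_v(√d)ˣ)`, `d = δ²`, `epsOf (a·δ) = (a · N(E_vˣ))_v`).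

* `isAdmissible_epsOf_iff_even` — **Def. 4.12 ⟺ parity**: for a CM field `E` with maximal totally real subfield
  `F = E⁺`, a CM type `Φ`, `δ ∈ E^{×−}` (the normaliser of `epsOf`), `d ∈ F^×` totally negative (`E = F(√d)`; e.g.
  `d = δ²` — `isAdmissible_epsOf_iff_even_of_coe_eq_mul_self` — or the pin's `imagUnitSq`) and a collection `ε ∈ Eps F d`:
  `ε` is `μ`-admissible (for `Φ = Φ_μ`) **iff** `ε_v` is the unit class for all but finitely many `v` and
  `#{v : ε_v ≠ 1} + #{φ ∈ Φ : Im φ(δ) > 0}` is EVEN.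
  Proof: an admissible `e` is `θ·δ` with `θ ∈ F^×` (`E^{×−} = δ·F^×`), `epsOf (θδ) = (θ·N(E_vˣ))_v`
  (`Def411WeilCarriers.epsOf_algebraMap_mul`), and `Im φ(θδ) = φ|_F(θ) · Im φ(δ)` with `Re φ(δ) = 0`
  (`IsCMField.complexEmbedding_complexConj`); through the bijection «`Φ` ↔ real places of `F`» of a CM type
  (`AppendixC.CMType.existsUnique_mem_restr_eq`) the archimedean clause becomes «`w(θ) < 0` exactly at the real places
  `w` under some `φ ∈ Φ` with `Im φ(δ) > 0`» (`embedding_of_isReal_lt_zero_of_coe_eq_mul_self`: `w(δ²) = −(Im φ_w(δ))²`); now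
  apply the generic theorem `QuadraticForms.exists_prescribed_normClass_sign_iff_even` (O'Meara 71:18/71:19, cell file
  `QuadraticForms/PrescribedNormClassesCM.lean`).
* `isAdmissible_epsOf_iff_even_card` — the same with the archimedean count written over the real places of `F`.

This is the arithmetic half of «Def. 4.12 ⟺ the sign of the multiplicity formula» ([Liu2021] Rem. 4.14; [Rogawski1990]
Thm. 14.6.4), the one step of Rem. 4.14 not printed as a lemma (cell hodgecm-mathlib, B3-DAG R8 / READFIRST-ROG §5 S6).
HC_CM is proved only modulo the 7 printed citations until rung 0 closes; this file proves no cell binder (banked leaf).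

## References
* [Liu2021] Y. Liu, Camb. J. Math. 9 (2021) = arXiv:2102.11518 — Def. 4.11 (l. 2083–2097), Def. 4.12 (l. 2102–2108),
  Rem. 4.14.
* [Omeara1963] O. T. O'Meara, *Introduction to Quadratic Forms* (1963), §71 Thm. 71:18, Thm. 71:19, Cor. 71:19a.
* [Rogawski1990] J. Rogawski, *Automorphic Representations of Unitary Groups in Three Variables* (1990), Thm. 14.6.4.
-/

noncomputable section

open NumberField IsDedekindDomain NumberField.InfinitePlace NumberField.ComplexEmbedding
open Literature.AlgebraicGeometry.Liu2021 (IsAdmissibleElement)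
open Literature.AlgebraicGeometry.Motives (CMType)
open Literature.NumberTheory.Automorphic.Liu2021.AppendixC (restr restr_apply_coe)

namespace Literature.NumberTheory.Automorphic.Liu2021

variable (K : Type) [Field K] [NumberField K] [IsCMField K]

/-! ### Bookkeeping: CM types of `E` over the real places of `F = E⁺`, and purely imaginary elements -/

variable {K} in
/-- For a CM field `E`, every complex embedding `φ` is CONJUGATION-EQUIVARIANT, so a purely imaginary `δ`
(`δ̄ = −δ`) has `Re φ(δ) = 0`. [cite: Liu2021, §4 preamble (l. 1884: `E^− = {e : e + e^c = 0}`)] -/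
theorem re_apply_eq_zero_of_complexConj_eq_neg (φ : K →+* ℂ) {δ : K} (hδ : IsCMField.complexConj K δ = -δ) :
    (φ δ).re = 0 := by
  have h := IsCMField.complexEmbedding_complexConj K φ δ
  rw [hδ, map_neg] at h
  have hre := congrArg Complex.re h
  rw [Complex.neg_re, Complex.conj_re] at hre
  linarith

variable {K} in
/-- … hence `Im φ(δ) ≠ 0` for `δ ≠ 0` purely imaginary. [cite: Liu2021, §4 preamble (l. 1884)] -/
theorem im_apply_ne_zero_of_complexConj_eq_neg (φ : K →+* ℂ) {δ : K} (hδ : IsCMField.complexConj K δ = -δ)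
    (hδ0 : δ ≠ 0) : (φ δ).im ≠ 0 := by
  intro him
  apply hδ0
  have hz : φ δ = 0 := Complex.ext (re_apply_eq_zero_of_complexConj_eq_neg φ hδ) him
  exact (map_eq_zero φ).1 hz

variable {K} in
omit [IsCMField K] in
/-- `Im φ(θ·δ) = φ|_F(θ) · Im φ(δ)` for `θ ∈ F = E⁺`. [cite: Liu2021, Def. 4.12 (l. 2105)] -/
theorem im_apply_algebraMap_mul (φ : K →+* ℂ) (θ : maximalRealSubfield K) (δ : K) :
    (φ (algebraMap (maximalRealSubfield K) K θ * δ)).im = restr (maximalRealSubfield K) K φ θ * (φ δ).im := by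
  rw [map_mul, ← restr_apply_coe, Complex.im_ofReal_mul]

variable {K} in
omit [IsCMField K] in
/-- The real embedding of the (real) place `w` of `F = E⁺` is the restriction of every `φ ∈ Hom(E, ℂ)` above `w`:
if `restr φ = σ_w` read through `mk`, i.e. `w = mk (φ|_F)`, then `embedding_of_isReal = restr φ`. [folklore] -/
private theorem embedding_of_isReal_eq_restr (φ : K →+* ℂ) {w : InfinitePlace (maximalRealSubfield K)} (hw : w.IsReal)
    (h : InfinitePlace.mk (φ.comp (algebraMap (maximalRealSubfield K) K)) = w) :
    InfinitePlace.embedding_of_isReal hw = restr (maximalRealSubfield K) K φ := by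
  have hreal : ComplexEmbedding.IsReal (φ.comp (algebraMap (maximalRealSubfield K) K)) :=
    IsTotallyReal.complexEmbedding_isReal _
  ext x
  apply Complex.ofReal_injective
  rw [InfinitePlace.embedding_of_isReal_apply, restr_apply_coe, ← h,
    InfinitePlace.embedding_mk_eq_of_isReal hreal, RingHom.comp_apply]

variable {K} in
/-- **The member of a CM type above a real place.**  For a CM type `Φ` of `E` and a real place `w` of `F = E⁺`
there is a unique `φ ∈ Φ` with `w = mk (φ|_F)` (Liu: «`π` induces a bijection from `Φ` to `Φ_F`»; tree
`AppendixC.CMType.existsUnique_mem_restr_eq`). [cite: Liu2021, App. C l. 4550] -/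
theorem existsUnique_mem_mk_comp_eq (Φ : CMType K) (w : InfinitePlace (maximalRealSubfield K)) :
    ∃! φ : K →+* ℂ, φ ∈ Φ.1 ∧ InfinitePlace.mk (φ.comp (algebraMap (maximalRealSubfield K) K)) = w := by
  have hw : w.IsReal := IsTotallyReal.isReal w
  obtain ⟨φ, ⟨hφ, hφw⟩, huniq⟩ :=
    AppendixC.CMType.existsUnique_mem_restr_eq (maximalRealSubfield K) K Φ (InfinitePlace.embedding_of_isReal hw)
  have key : ∀ ψ : K →+* ℂ, InfinitePlace.mk (ψ.comp (algebraMap (maximalRealSubfield K) K)) = w ↔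
      restr (maximalRealSubfield K) K ψ = InfinitePlace.embedding_of_isReal hw := by
    intro ψ
    constructor
    · intro h
      exact (embedding_of_isReal_eq_restr ψ hw h).symm
    · intro h
      rw [AppendixC.comp_algebraMap_eq_restr, h]
      have : Complex.ofRealHom.comp (InfinitePlace.embedding_of_isReal hw) = w.embedding := by
        ext x
        simp [InfinitePlace.embedding_of_isReal_apply]
      rw [this, InfinitePlace.mk_embedding]
  exact ⟨φ, ⟨hφ, (key φ).2 hφw⟩, fun ψ hψ => huniq ψ ⟨hψ.1, (key ψ).1 hψ.2⟩⟩

variable {K} in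
omit [NumberField K] [IsCMField K] in
/-- `d = δ²` for a purely imaginary `δ ≠ 0` is non-zero. [cite: Liu2021, §4 preamble (l. 1884)] -/
theorem ne_zero_of_coe_eq_mul_self {δ : K} (hδ0 : δ ≠ 0) {d : maximalRealSubfield K} (hd : (d : K) = δ * δ) :
    d ≠ 0 := by
  intro h
  apply hδ0
  have : (d : K) = 0 := by rw [h]; rfl
  rw [hd] at this
  exact mul_self_eq_zero.1 this

variable {K} in
/-- **`d = δ²` is negative at every real place of `F = E⁺`** for a purely imaginary `δ ≠ 0` of the CM field `E`:
`σ_w(d) = φ_w(δ)² = −(Im φ_w(δ))²` for the member `φ_w` of any CM type above `w`.  (So `E = F(√d)` with `d`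
totally negative — the shape in which O'Meara 71:19 is applied.) [cite: Liu2021, §4 preamble (l. 1880–1890)] -/
theorem embedding_of_isReal_lt_zero_of_coe_eq_mul_self {δ : K} (hδ : IsCMField.complexConj K δ = -δ) (hδ0 : δ ≠ 0)
    {d : maximalRealSubfield K} (hd : (d : K) = δ * δ) (w : InfinitePlace (maximalRealSubfield K)) (hw : w.IsReal) :
    InfinitePlace.embedding_of_isReal hw d < 0 := by
  -- a complex embedding of `K` above `w`
  obtain ⟨φ, hφ⟩ := AppendixC.exists_restr_eq (maximalRealSubfield K) K (InfinitePlace.embedding_of_isReal hw)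
  have h1 : (InfinitePlace.embedding_of_isReal hw d : ℂ) = φ δ * φ δ := by
    rw [← hφ, restr_apply_coe, show algebraMap (maximalRealSubfield K) K d = (d : K) from rfl, hd, map_mul]
  have hre := re_apply_eq_zero_of_complexConj_eq_neg φ hδ
  have him := im_apply_ne_zero_of_complexConj_eq_neg φ hδ hδ0
  have h2 : InfinitePlace.embedding_of_isReal hw d = -((φ δ).im * (φ δ).im) := by
    have := congrArg Complex.re h1
    rw [Complex.ofReal_re, Complex.mul_re, hre] at this
    linarith
  rw [h2, neg_lt_zero]
  exact mul_self_pos.2 him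

/-! ### Def. 4.12 ⟺ parity -/

open scoped Classical in
/-- **[Liu2021, Def. 4.12] «`ε` is `μ`-admissible» ⟺ parity of the local symbols**, archimedean count over the real
places of `F = E⁺`.  Let `E` be a CM field, `Φ` a CM type of `E` (for Liu, `Φ = Φ_μ`), `δ ∈ E^{×−}` (`δ̄ = −δ`,
`δ ≠ 0`) — the lane's normaliser of the collections —, `d ∈ F^×` TOTALLY NEGATIVE (e.g. `d = δ²`, or the pin's
`imagUnitSq`; `E = F(√d)`, no relation between `d` and `δ` is needed), and `ε = (ε_v)_v ∈ Π_v F_vˣ / N(F_v(√d)ˣ)` a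
collection of local norm classes (`Def411WeilCarriers.Eps F d`).  Then there is `e ∈ E^{×−}` with `ε_v = e·N(E_vˣ)` for all finite `v` (i.e.
`epsOf e = ε`) and `Im φ(e) < 0` for all `φ ∈ Φ` **iff** `{v : ε_v ≠ 1}` is finite and
`#{v : ε_v ≠ 1} + #{w real place of F : Im φ_w(δ) > 0}` is even, `φ_w` the member of `Φ` above `w`.
(`e = θ·δ` with `θ ∈ F^×`; `Im φ_w(θδ) = w(θ)·Im φ_w(δ)`; `d` is negative at every real place; then the generic
theorem `QuadraticForms.exists_prescribed_normClass_sign_iff_even` = O'Meara 71:18/71:19.)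
[cite: Liu2021, Def. 4.12 (l. 2102–2108), Rem. 4.14] [cite: Omeara1963, §71 Thm. 71:18, Thm. 71:19, Cor. 71:19a] -/
theorem isAdmissible_epsOf_iff_even_card (Φ : CMType K) {δ : K} (hδ : IsCMField.complexConj K δ = -δ) (hδ0 : δ ≠ 0)
    (d : maximalRealSubfield K) (hd0 : d ≠ 0)
    (hdneg : ∀ (w : InfinitePlace (maximalRealSubfield K)) (hw : w.IsReal), InfinitePlace.embedding_of_isReal hw d < 0)
    (ε : Def411WeilCarriers.Eps (maximalRealSubfield K) d) :
    (∃ e : K, IsAdmissibleElement K Φ.1 e ∧ Def411WeilCarriers.epsOf (maximalRealSubfield K) d K δ e = ε) ↔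
      ({v : HeightOneSpectrum (𝓞 (maximalRealSubfield K)) | ε v ≠ 1}.Finite ∧
        Even ({v : HeightOneSpectrum (𝓞 (maximalRealSubfield K)) | ε v ≠ 1}.ncard +
          (Finset.univ.filter fun w : InfinitePlace (maximalRealSubfield K) =>
            ∃ φ ∈ Φ.1, InfinitePlace.mk (φ.comp (algebraMap (maximalRealSubfield K) K)) = w ∧ 0 < (φ δ).im).card)) := by
  classical
  -- the member of `Φ` above each (real) place of `F`
  choose φw hφw huniq using existsUnique_mem_mk_comp_eq Φ
  have hreal : ∀ w : InfinitePlace (maximalRealSubfield K), w.IsReal := fun w => IsTotallyReal.isReal w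
  have hemb : ∀ w : InfinitePlace (maximalRealSubfield K),
      InfinitePlace.embedding_of_isReal (hreal w) = restr (maximalRealSubfield K) K (φw w) := fun w =>
    embedding_of_isReal_eq_restr (φw w) (hreal w) (hφw w).2
  -- members of `Φ` are `φw` of their place
  have hmem : ∀ φ ∈ Φ.1, φ = φw (InfinitePlace.mk (φ.comp (algebraMap (maximalRealSubfield K) K))) :=
    fun φ hφ => huniq _ φ ⟨hφ, rfl⟩
  -- the archimedean set, as «`0 < Im (φw w) δ`»
  set T : Finset (InfinitePlace (maximalRealSubfield K)) := Finset.univ.filter fun w =>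
      ∃ φ ∈ Φ.1, InfinitePlace.mk (φ.comp (algebraMap (maximalRealSubfield K) K)) = w ∧ 0 < (φ δ).im with hT
  have hmemT : ∀ w, w ∈ T ↔ 0 < (φw w δ).im := by
    intro w
    rw [hT, Finset.mem_filter]
    simp only [Finset.mem_univ, true_and]
    constructor
    · rintro ⟨φ, hφ, hφw', hpos⟩
      rwa [hmem φ hφ, hφw'] at hpos
    · intro hpos
      exact ⟨φw w, (hφw w).1, (hφw w).2, hpos⟩
  -- STEP 1: admissible `e` with `epsOf e = ε` ⟷ `θ ∈ F^×` with `locF θ = ε` and `Im φ(θδ) < 0` on `Φ`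
  have step1 : (∃ e : K, IsAdmissibleElement K Φ.1 e ∧ Def411WeilCarriers.epsOf (maximalRealSubfield K) d K δ e = ε) ↔
      ∃ θ : (maximalRealSubfield K)ˣ, Def411WeilCarriers.locF (maximalRealSubfield K) d θ = ε ∧
        ∀ φ ∈ Φ.1, (φ (algebraMap (maximalRealSubfield K) K θ * δ)).im < 0 := by
    constructor
    · rintro ⟨e, ⟨he0, hec, heim⟩, hε⟩
      have hmemF : e * δ⁻¹ ∈ maximalRealSubfield K := by
        rw [← IsCMField.complexConj_eq_self_iff, map_mul, map_inv₀, hδ, hec, inv_neg, neg_mul_neg]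
      have hθ0 : (⟨e * δ⁻¹, hmemF⟩ : maximalRealSubfield K) ≠ 0 := by
        intro h
        have : e * δ⁻¹ = 0 := congrArg Subtype.val h
        exact mul_ne_zero he0 (inv_ne_zero hδ0) this
      refine ⟨Units.mk0 _ hθ0, ?_, ?_⟩
      · rw [← hε, ← Def411WeilCarriers.epsOf_algebraMap_mul (maximalRealSubfield K) d K δ hδ0]
        congr 1
        change e * δ⁻¹ * δ = e
        rw [inv_mul_cancel_right₀ hδ0]
      · intro φ hφ
        have : algebraMap (maximalRealSubfield K) K (Units.mk0 _ hθ0 : (maximalRealSubfield K)ˣ) * δ = e := by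
          change e * δ⁻¹ * δ = e
          rw [inv_mul_cancel_right₀ hδ0]
        rw [this]
        exact heim φ hφ
    · rintro ⟨θ, hθ, him⟩
      refine ⟨algebraMap (maximalRealSubfield K) K θ * δ, ⟨?_, ?_, him⟩, ?_⟩
      · exact mul_ne_zero ((map_ne_zero _).2 θ.ne_zero) hδ0
      · rw [map_mul, hδ, AlgEquiv.commutes, mul_neg]
      · rw [Def411WeilCarriers.epsOf_algebraMap_mul (maximalRealSubfield K) d K δ hδ0, hθ]
  -- STEP 2: the archimedean clause on `Φ` ⟷ «`w(θ) < 0` exactly on `T`»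
  have step2 : ∀ θ : (maximalRealSubfield K)ˣ,
      (∀ φ ∈ Φ.1, (φ (algebraMap (maximalRealSubfield K) K θ * δ)).im < 0) ↔
        ∀ (w : InfinitePlace (maximalRealSubfield K)) (hw : w.IsReal),
          InfinitePlace.embedding_of_isReal hw (θ : maximalRealSubfield K) < 0 ↔ w ∈ T := by
    intro θ
    -- the value of the clause at `φw w`
    have hval : ∀ w : InfinitePlace (maximalRealSubfield K),
        ((φw w) (algebraMap (maximalRealSubfield K) K θ * δ)).im < 0 ↔
          (InfinitePlace.embedding_of_isReal (hreal w) (θ : maximalRealSubfield K) < 0 ↔ w ∈ T) := by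
      intro w
      rw [im_apply_algebraMap_mul, ← hemb w, hmemT w]
      have hr : InfinitePlace.embedding_of_isReal (hreal w) (θ : maximalRealSubfield K) ≠ 0 :=
        (map_ne_zero _).2 θ.ne_zero
      have hi := im_apply_ne_zero_of_complexConj_eq_neg (φw w) hδ hδ0
      rcases lt_or_gt_of_ne hr with hrn | hrp <;> rcases lt_or_gt_of_ne hi with hin | hip
      · constructor
        · intro h; exact absurd (mul_pos_of_neg_of_neg hrn hin) (not_lt.2 h.le)
        · intro h; exact absurd (h.1 hrn) (not_lt.2 hin.le)
      · exact ⟨fun _ => ⟨fun _ => hip, fun _ => hrn⟩, fun _ => mul_neg_of_neg_of_pos hrn hip⟩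
      · exact ⟨fun _ => ⟨fun h => absurd h (not_lt.2 hrp.le), fun h => absurd h (not_lt.2 hin.le)⟩,
          fun _ => mul_neg_of_pos_of_neg hrp hin⟩
      · constructor
        · intro h; exact absurd (mul_pos hrp hip) (not_lt.2 h.le)
        · intro h; exact absurd (h.2 hip) (not_lt.2 hrp.le)
    constructor
    · intro h w hw
      rw [show InfinitePlace.embedding_of_isReal hw = InfinitePlace.embedding_of_isReal (hreal w) from rfl]
      exact (hval w).1 (h (φw w) (hφw w).1)
    · intro h φ hφ
      rw [hmem φ hφ]
      exact (hval _).2 (h _ (hreal _))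
  -- STEP 3: the generic theorem (O'Meara 71:18/71:19) for `a := d`, real places `T`
  rw [step1]
  have hgen := QuadraticForms.exists_prescribed_normClass_sign_iff_even (maximalRealSubfield K) (d : maximalRealSubfield K)
    hd0 hdneg ε T (fun w _ => hreal w)
  rw [← hgen]
  constructor
  · rintro ⟨θ, hθ, him⟩
    refine ⟨θ, fun v => ?_, (step2 θ).1 him⟩
    rw [← hθ]
    rfl
  · rintro ⟨θ, hθ, hsign⟩
    refine ⟨θ, ?_, (step2 θ).2 hsign⟩
    funext v
    rw [← hθ v]
    rfl

open scoped Classical in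
/-- **[Liu2021, Def. 4.12] «`ε` is `μ`-admissible» ⟺ parity**, archimedean count over the CM type itself:
there is `e ∈ E^{×−}` with `epsOf e = ε` and `Im φ(e) < 0` on `Φ` **iff** `{v : ε_v ≠ 1}` is finite and
`#{v : ε_v ≠ 1} + #{φ ∈ Φ : Im φ(δ) > 0}` is even (the CM type `Φ` is in bijection with the real places of `F`
under restriction, [Liu2021] App. C l. 4550).  This parity is the sign `ε(ξ, μ)·(−1)^{n(π)}` side of Rogawski's
multiplicity formula read on oscillator data ([Liu2021] Rem. 4.14).
[cite: Liu2021, Def. 4.12 (l. 2102–2108), Rem. 4.14; App. C l. 4550] [cite: Omeara1963, §71 Thm. 71:18, Thm. 71:19, Cor. 71:19a] -/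
theorem isAdmissible_epsOf_iff_even (Φ : CMType K) {δ : K} (hδ : IsCMField.complexConj K δ = -δ) (hδ0 : δ ≠ 0)
    (d : maximalRealSubfield K) (hd0 : d ≠ 0)
    (hdneg : ∀ (w : InfinitePlace (maximalRealSubfield K)) (hw : w.IsReal), InfinitePlace.embedding_of_isReal hw d < 0)
    (ε : Def411WeilCarriers.Eps (maximalRealSubfield K) d) :
    (∃ e : K, IsAdmissibleElement K Φ.1 e ∧ Def411WeilCarriers.epsOf (maximalRealSubfield K) d K δ e = ε) ↔
      ({v : HeightOneSpectrum (𝓞 (maximalRealSubfield K)) | ε v ≠ 1}.Finite ∧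
        Even ({v : HeightOneSpectrum (𝓞 (maximalRealSubfield K)) | ε v ≠ 1}.ncard +
          {φ : K →+* ℂ | φ ∈ Φ.1 ∧ 0 < (φ δ).im}.ncard)) := by
  classical
  rw [isAdmissible_epsOf_iff_even_card K Φ hδ hδ0 d hd0 hdneg ε]
  -- the two archimedean counts agree: `w ↦ φ_w` is a bijection from `T` onto `{φ ∈ Φ | 0 < Im φ(δ)}`
  suffices hcard : (Finset.univ.filter fun w : InfinitePlace (maximalRealSubfield K) =>
      ∃ φ ∈ Φ.1, InfinitePlace.mk (φ.comp (algebraMap (maximalRealSubfield K) K)) = w ∧ 0 < (φ δ).im).card =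
      {φ : K →+* ℂ | φ ∈ Φ.1 ∧ 0 < (φ δ).im}.ncard by
    rw [hcard]
  choose φw hφw huniq using existsUnique_mem_mk_comp_eq Φ
  have hmem : ∀ φ ∈ Φ.1, φ = φw (InfinitePlace.mk (φ.comp (algebraMap (maximalRealSubfield K) K))) :=
    fun φ hφ => huniq _ φ ⟨hφ, rfl⟩
  set T : Finset (InfinitePlace (maximalRealSubfield K)) := Finset.univ.filter fun w =>
      ∃ φ ∈ Φ.1, InfinitePlace.mk (φ.comp (algebraMap (maximalRealSubfield K) K)) = w ∧ 0 < (φ δ).im with hT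
  have hmemT : ∀ w, w ∈ T ↔ 0 < (φw w δ).im := by
    intro w
    rw [hT, Finset.mem_filter]
    simp only [Finset.mem_univ, true_and]
    constructor
    · rintro ⟨φ, hφ, hφw', hpos⟩
      rwa [hmem φ hφ, hφw'] at hpos
    · intro hpos
      exact ⟨φw w, (hφw w).1, (hφw w).2, hpos⟩
  have hinj : Function.Injective φw := by
    intro w w' h
    rw [← (hφw w).2, ← (hφw w').2, h]
  have himage : (↑(T.image φw) : Set (K →+* ℂ)) = {φ : K →+* ℂ | φ ∈ Φ.1 ∧ 0 < (φ δ).im} := by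
    ext φ
    rw [Finset.coe_image, Set.mem_image, Set.mem_setOf_eq]
    constructor
    · rintro ⟨w, hw, rfl⟩
      exact ⟨(hφw w).1, (hmemT w).1 hw⟩
    · rintro ⟨hφ, hpos⟩
      refine ⟨InfinitePlace.mk (φ.comp (algebraMap (maximalRealSubfield K) K)), ?_, (hmem φ hφ).symm⟩
      rw [Finset.mem_coe, hmemT, ← hmem φ hφ]
      exact hpos
  rw [← himage, Set.ncard_coe_finset, Finset.card_image_of_injective _ hinj]

open scoped Classical in
/-- **[Liu2021, Def. 4.12] ⟺ parity, with `d = δ²`** (the binder shape `(d : E) = δ·δ`; `d` is then non-zero and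
totally negative by `embedding_of_isReal_lt_zero_of_coe_eq_mul_self`).
[cite: Liu2021, Def. 4.12 (l. 2102–2108), Rem. 4.14] [cite: Omeara1963, §71 Thm. 71:18, Thm. 71:19, Cor. 71:19a] -/
theorem isAdmissible_epsOf_iff_even_of_coe_eq_mul_self (Φ : CMType K) {δ : K} (hδ : IsCMField.complexConj K δ = -δ)
    (hδ0 : δ ≠ 0) (d : maximalRealSubfield K) (hd : (d : K) = δ * δ)
    (ε : Def411WeilCarriers.Eps (maximalRealSubfield K) d) :
    (∃ e : K, IsAdmissibleElement K Φ.1 e ∧ Def411WeilCarriers.epsOf (maximalRealSubfield K) d K δ e = ε) ↔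
      ({v : HeightOneSpectrum (𝓞 (maximalRealSubfield K)) | ε v ≠ 1}.Finite ∧
        Even ({v : HeightOneSpectrum (𝓞 (maximalRealSubfield K)) | ε v ≠ 1}.ncard +
          {φ : K →+* ℂ | φ ∈ Φ.1 ∧ 0 < (φ δ).im}.ncard)) :=
  isAdmissible_epsOf_iff_even K Φ hδ hδ0 d (ne_zero_of_coe_eq_mul_self hδ0 hd)
    (embedding_of_isReal_lt_zero_of_coe_eq_mul_self hδ hδ0 hd) ε

end Literature.NumberTheory.Automorphic.Liu2021

end
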